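import Summits.BirchSwinnertonDyer.BirchSwinnertonDyer.Theorems.KatoDescentPotSupersingularKatoFiniteLevelStrictCompactMap
import Literature.NumberTheory.EllipticCurves.TateModuleProjSurjectiveProofs
import Literature.NumberTheory.EllipticCurves.TateModuleBaseChange
import HarnessLib

/-!
# Kato's (14.9.3) at finite level, part 18: the COMPACT HALF, step 2 — `ker (H¹(U, T_pE) → H¹(U, E[p^k])) = p^k · H¹(U, T_pE)`
# (the long exact sequence of `0 → T →p^k→ T → E[p^k] → 0` for the compact Tate module, at `H¹`)
# (route `KatoDescentPotSupersingular` / `…Tame…`, crux M = stmt-BirchSwinnertonDyer-19196 `ReducibleKatoMember`; route-free helper)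

Seat `bsd-potss-rkm` g17 (prover; cell `bsd-potss`), item stmt-BirchSwinnertonDyer-19196 (`--supports … --as helper`; closes
nothing).  HONEST FRAMING: BSD is not proved by any of this; nothing is booked; theorems only (no definition, no named fact).

Part 17 (`…StrictCompactMap`) built `A = H¹(ℤ[1/p], T_pE) → H¹_ℛ(ℚ, E[p^k])`, `c ↦ c mod p^k`, with kernel `⊇ p^k A`.  Here the
kernel of the reduction `Kato2004.reduceH1Pk W p k U : H¹(U, T_pE) → H¹(U, E[p^k])` is identified at every level `U ≤ Γ_ℚ`:

* **`exists_pow_smul_eq_of_reduceH1Pk_eq_zero`** — if `c mod p^k = 0` then `c = p^k • c'` for some `c' ∈ H¹(U, T_pE)`.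
  Cocycle proof (Kato §13.8; Serre, *Galois Cohomology* I §2.2): `c = [φ]` with `φ mod p^k = ∂m`, `m ∈ E[p^k]`; lift `m` to
  `m̃ ∈ T_pE` (tree `proj_surjective_of_isAlgClosed_holds`), so `φ' = φ − ∂m̃` has values in `ker(T_pE → E[p^k]) = p^k T_pE`;
  the quotient `ψ = p^{-k} φ'` is the compatible sequence `ψ(g)_n = φ'(g)_{n+k}` (tree `TateModule.mk`), continuous
  componentwise, and a cocycle by torsion-freeness (tree `TateModule.eq_zero_of_pow_smul_eq_zero`); `c = [φ'] = p^k • [ψ]`.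
* **`reduceH1Pk_eq_zero_iff`** — `reduceH1Pk c = 0 ↔ ∃ c', p^k • c' = c` (with tree `reduceH1Pk_pow_smul`).
* **`ker_integralH1_to_selmerGroup_le`** — for the map `f` of part 17: `f c = 0 ↔ (c : H¹) ∈ p^k · H¹(⊤, T_pE)`, i.e.
  `ker f = A ∩ p^k H¹(ℚ, T_pE)` — so part 17's bound reads **`#(A / (A ∩ p^k H¹(ℚ,T_pE))) ≤ #H¹_ℛ(ℚ, E[p^k])`**, Kato's
  injection `H¹(ℤ[1/p],T)/(…) ↪ H¹(ℤ[1/p], T/p^k)` of the proof of Prop. 14.16.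

References: K. Kato, Astérisque 295 (2004) §13.8 (p. 228), proof of Prop. 14.16 (pp. 244–245) [Kato2004Asterisque]; J.-P. Serre,
*Galois Cohomology* I §2.2 [SerreGaloisCohomology1997]; J. H. Silverman, *AEC* III §7 [SilvermanAEC2009].
-/

-- the summit and its single problem are both named `BirchSwinnertonDyer` (registry layout D-0017)
set_option linter.dupNamespace false
set_option autoImplicit false

noncomputable section

open scoped Classical ContRepresentation NumberField
open Function Field NumberField IsDedekindDomain
open Literature.NumberTheory.EllipticCurves Literature.NumberTheory.GaloisRepresentations
  Literature.NumberTheory.GaloisRepresentations.DiscreteGaloisModule Literature.NumberTheory.GaloisCohomology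
open Literature.NumberTheory.EllipticCurves.Kato2004 Literature.NumberTheory.EllipticCurves.Kato2004.EulerSystemValues
open Literature.NumberTheory.EllipticCurves.TateModule (proj)
open WeierstrassCurve (geomTorsion geomPoints)

namespace Summit.BirchSwinnertonDyer.BirchSwinnertonDyer.Theorems.KatoFiniteLevelCount

section CompactKernel

variable (W : WeierstrassCurve ℚ) [W.IsElliptic] (p : ℕ) [Fact p.Prime] (k : ℕ) [ContinuousSMul ℤ_[p] (W.tateModule p)]

/-- **`ker (H¹(U, T_pE) → H¹(U, E[p^k])) ⊆ p^k · H¹(U, T_pE)`**: a class whose reduction mod `p^k` vanishes is a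
`p^k`-multiple (see the module docstring for the cocycle argument). [cite: Kato2004Asterisque, §13.8 (p. 228)]
[cite: SerreGaloisCohomology1997, I §2.2] -/
theorem exists_pow_smul_eq_of_reduceH1Pk_eq_zero (U : Subgroup (absoluteGaloisGroup ℚ)) (c : H1 (tateRep W p) U)
    (hc : reduceH1Pk W p k U c = 0) : ∃ c' : H1 (tateRep W p) U, ((p : ℤ_[p]) ^ k) • c' = c := by
  have hp : p.Prime := Fact.out
  set X := subgroupRep (tateRep W p).toTopRep U with hX
  set Y := subgroupRep (W.torsionGaloisModule ((p : ℤ) ^ k)).toTopRep U with hY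
  obtain ⟨φ, rfl⟩ := oneCocycleClass_surjective X c
  rw [reduceH1Pk_oneCocycleClass, oneCocycleClass_eq_zero_iff] at hc
  obtain ⟨m, hm⟩ := hc
  -- lift `m ∈ E[p^k]` to `m̃ ∈ T_pE`
  have hmtors : ((m : geomTorsion W ((p : ℤ) ^ k)) : geomPoints W) ∈ geomTorsion W ((p ^ k : ℕ) : ℤ) := by
    rw [Nat.cast_pow]; exact m.2
  obtain ⟨mt, hmt⟩ := WeierstrassCurve.proj_surjective_of_isAlgClosed_holds W p k hmtors
  have hmt' : tateModPk W p k mt = m := Subtype.ext (by rw [coe_tateModPk_apply, hmt])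
  -- the coboundary `∂m̃` and `φ' = φ − ∂m̃`
  have horbit : Continuous fun g : U => X.ρ g mt := by
    have h := (tateRep W p).continuous_smul.comp
      ((continuous_subtype_val (p := fun g => g ∈ U)).prodMk (continuous_const (y := mt)))
    exact h
  let cob : contOneCocycles X :=
    ⟨⟨fun g => X.ρ g mt - mt, horbit.sub continuous_const⟩, (mem_contOneCocycles_iff _).mpr fun g h => by
      change X.ρ (g * h) mt - mt = (X.ρ g mt - mt) + X.ρ g (X.ρ h mt - mt)
      rw [map_sub, ρ_mul_apply]; abel⟩
  have hcob : oneCocycleClass X cob = 0 := (oneCocycleClass_eq_zero_iff X cob).mpr ⟨mt, fun _ => rfl⟩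
  set φ' : contOneCocycles X := φ - cob with hφ'
  -- `φ'` has values in `ker (T_pE → E[p^k])`
  have hφ'val : ∀ g : U, φ'.1 g = φ.1 g - (X.ρ g mt - mt) := fun g => rfl
  have hker : ∀ g : U, tateModPk W p k (φ'.1 g) = 0 := by
    intro g
    rw [hφ'val, map_sub, map_sub, tateModPk_subgroupRep W p k U g mt, hmt']
    have h := hm g
    rw [contOneCocycles.pushAddHom_apply] at h
    rw [h, sub_self]
  have hprojk : ∀ g : U, proj p k (φ'.1 g) = 0 := fun g => by
    have h := congrArg Subtype.val (hker g)
    rwa [coe_tateModPk_apply] at h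
  -- the quotient `ψ = p^{-k} φ'`, componentwise `ψ(g)_n = φ'(g)_{n+k}`
  let ψfun : U → W.tateModule p := fun g =>
    TateModule.mk (fun n => proj p (n + k) (φ'.1 g))
      (fun n => by rw [TateModule.pow_smul_proj_self_add n k, hprojk g])
      (fun n => by rw [Nat.add_right_comm]; exact TateModule.smul_proj_succ (n + k) (φ'.1 g))
  have hψcont : Continuous ψfun :=
    TateModule.continuous_of_proj fun n => (TateModule.continuous_proj (n + k)).comp φ'.1.continuous
  have key : ∀ g : U, ((p : ℤ_[p]) ^ k) • ψfun g = φ'.1 g := by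
    intro g
    ext n
    rw [TateModule.proj_pow_smul, show proj p n (ψfun g) = proj p (n + k) (φ'.1 g) from rfl, Nat.add_comm,
      TateModule.pow_smul_proj_self_add k n]
  have hinj : ∀ a b : W.tateModule p, ((p : ℤ_[p]) ^ k) • a = ((p : ℤ_[p]) ^ k) • b → a = b := fun a b h =>
    sub_eq_zero.mp (TateModule.eq_zero_of_pow_smul_eq_zero (k := k) (by rw [smul_sub, h, sub_self]))
  have hcoc : ∀ g h : U, ψfun (g * h) = ψfun g + X.ρ g (ψfun h) := by
    intro g h
    apply hinj
    rw [key, smul_add, ← map_smul, key, key]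
    exact (mem_contOneCocycles_iff _).mp φ'.2 g h
  let ψ : contOneCocycles X := ⟨⟨ψfun, hψcont⟩, (mem_contOneCocycles_iff _).mpr hcoc⟩
  have hψ : ((p : ℤ_[p]) ^ k) • ψ = φ' :=
    Subtype.ext (ContinuousMap.ext fun g => by
      rw [Submodule.coe_smul, ContinuousMap.smul_apply]; exact key g)
  refine ⟨oneCocycleClass X ψ, ?_⟩
  rw [← oneCocycleClass_smul, hψ, hφ', oneCocycleClass_sub, hcob, sub_zero]

/-- **`ker (reduceH1Pk) = p^k · H¹(U, T_pE)`** (with tree `reduceH1Pk_pow_smul` for `⊇`). [cite: Kato2004Asterisque, §13.8 (p. 228)] -/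
theorem reduceH1Pk_eq_zero_iff (U : Subgroup (absoluteGaloisGroup ℚ)) (c : H1 (tateRep W p) U) :
    reduceH1Pk W p k U c = 0 ↔ ∃ c' : H1 (tateRep W p) U, ((p : ℤ_[p]) ^ k) • c' = c := by
  refine ⟨exists_pow_smul_eq_of_reduceH1Pk_eq_zero W p k U c, ?_⟩
  rintro ⟨c', rfl⟩
  exact reduceH1Pk_pow_smul W p k U c'

/-- **The kernel of part 17's map `A → H¹_ℛ(ℚ, E[p^k])` is `A ∩ p^k H¹(ℚ, T_pE)`**: for `c ∈ A = H¹(ℤ[1/p], T_pE)`,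
`(c mod p^k) = 0` in `H¹_ℛ` iff `c ∈ p^k · H¹(⊤, T_pE)` (`ofTopSubgroup` is injective, tree `eq_zero_of_ofTopSubgroup_eq_zero`).
Hence part 17's `#(A ⧸ ker f) ≤ #H¹_ℛ(ℚ, E[p^k])` is Kato's injection `A/(A ∩ p^k H¹(ℚ,T)) ↪ H¹(ℤ[1/p], T/p^k)`.
[cite: Kato2004Asterisque, proof of Prop. 14.16 (pp. 244–245)] -/
theorem ofTopSubgroup_reduceH1Pk_eq_zero_iff (c : H1 (tateRep W p) ⊤) :
    (ofTopSubgroup (W.torsionGaloisModule ((p : ℤ) ^ k)).toTopRep 1).hom (reduceH1Pk W p k ⊤ c) = 0 ↔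
      ∃ c' : H1 (tateRep W p) ⊤, ((p : ℤ_[p]) ^ k) • c' = c := by
  rw [← reduceH1Pk_eq_zero_iff]
  refine ⟨fun h => eq_zero_of_ofTopSubgroup_eq_zero (c := reduceH1Pk W p k ⊤ c) (hc := h), fun h => by rw [h, map_zero]⟩

end CompactKernel

end Summit.BirchSwinnertonDyer.BirchSwinnertonDyer.Theorems.KatoFiniteLevelCount

end
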